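import Summits.QuantumAdvantage.QuantumAdvantage.Theorems.SpreadCoreBridgeB

/-! # SpreadCoreBridge — part 3/3 (mechanical split for landing of `SpreadCoreBridge`; content verbatim; scopes re-opened with their variables) -/

open Finset
open Literature.Computability.Cryptography Literature.Computability.Complexity
open Literature.Computability.QuantumComplexity Literature.Computability.MetaComplexity
set_option linter.dupNamespace false

namespace Summit.QuantumAdvantage.QuantumAdvantage.Theorems.SpreadCore
open Summit.QuantumAdvantage.AdviceFreeQNC0 Summit.QuantumAdvantage.QuantumAdvantage.Theorems
open scoped Classical
open Summit.QuantumAdvantage.QuantumAdvantage.Theses.HardCore (RingPolyLoss8Odd GridCoreDistOdd DistLiftOdd DistBridgeOdd RingCore8Odd)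

/-! ## Part E.  THE WEIGHTED PACKING (PROVED edge `MultiRingDistOdd → GridCoreDistOdd`)

Pack `(8t)^K` disjoint `8t`-squares into the `N × N` grid (`t` maximal with `(8t)^K(2t+1) ≤ N`), take for the hard
family `H` the many-ring instances `ringsInstance Γ X` over ALL joint patterns `X`, weighted by the PRODUCT weight
`wt_H (ringsInstance Γ X) = ∏_j wt (X j)`; a grid strategy `P` (polynomials over the `inLen N` input bits, degree
`≤ (log₂ N)^c`) induces ONE joint strategy for all rings by the substitution `u ↦ encodeHLF (ringsInstance Γ (unflat u))`
(coordinates constant or single pattern bits: `encodeHLF_ringsInstance_subst`, so degrees do not grow: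
`Smolensky.comp_subst_mem_lowDeg`), of degree `≤ (log₂ N)^c ≤ (log₂ 8t)^{c+1}` by the maximality of `t`; a grid win is an
all-rings win (`rel_of_mem_hlfSolutions`), so the weighted solved mass is at most `θ·(Σ wt)^{(8t)^K} = θ·Σ_H wt_H`. -/

/-- Un-flattening of a joint pattern. [bookkeeping] -/
def unflat {J n : ℕ} (u : Fin (J * n) → Bool) : Fin J → Fin n → Bool :=
  fun j i => u (finProdFinEquiv (j, i))

/-- SpreadCore bridge helper `unflat_flat_fun` (lens-6 g6 SpreadCoreBridge v2; see the enclosing section docstring). -/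
theorem unflat_flat_fun {J n : ℕ} (X : Fin J → Fin n → Bool) :
    unflat (fun kk : Fin (J * n) => X (finProdFinEquiv.symm kk).1 (finProdFinEquiv.symm kk).2) = X := by
  funext j i
  simp only [unflat, Equiv.symm_apply_apply]

/-- Arithmetic: if `L + 1 ≤ (Ln + 2)(K + 1)`, `1 ≤ Ln` and `(3(K+1))^c ≤ Ln` then `L^c ≤ Ln^{c+1}`. -/
theorem degree_bound_dist {K L Ln c : ℕ} (hL : L + 1 ≤ (Ln + 2) * (K + 1)) (hLn : 1 ≤ Ln)
    (hA : (3 * (K + 1)) ^ c ≤ Ln) : L ^ c ≤ Ln ^ (c + 1) := by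
  have h1 : L ≤ 3 * (K + 1) * Ln := by
    have h3 : (Ln + 2) * (K + 1) ≤ 3 * Ln * (K + 1) := Nat.mul_le_mul_right _ (by omega)
    calc L ≤ L + 1 := Nat.le_succ L
      _ ≤ (Ln + 2) * (K + 1) := hL
      _ ≤ 3 * Ln * (K + 1) := h3
      _ = 3 * (K + 1) * Ln := by ring
  calc L ^ c ≤ (3 * (K + 1) * Ln) ^ c := Nat.pow_le_pow_left h1 _
    _ = (3 * (K + 1)) ^ c * Ln ^ c := by rw [mul_pow]
    _ ≤ Ln * Ln ^ c := Nat.mul_le_mul_right _ hA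
    _ = Ln ^ (c + 1) := by ring

/-- Maximality of the packing parameter: `(8t)^K(2t+1) ≤ N < (8(t+1))^K(2t+3)` gives `log₂ N + 1 ≤ (log₂ 8t + 2)(K+1)`.
[arithmetic; as in lens-5's bridge] -/
theorem log_bound_of_maximal {N K t : ℕ} (hN0 : N ≠ 0) (ht1 : 1 ≤ t)
    (hnot : ¬ ((8 * (t + 1)) ^ K * (2 * (t + 1) + 1) ≤ N)) :
    Nat.log 2 N + 1 ≤ (Nat.log 2 (8 * t) + 2) * (K + 1) := by
  set Ln : ℕ := Nat.log 2 (8 * t) with hLn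
  have h16 : (8 * (t + 1)) ^ K * (2 * (t + 1) + 1) ≤ (16 * t) ^ (K + 1) := by
    rw [pow_succ]
    exact Nat.mul_le_mul (Nat.pow_le_pow_left (by omega) K) (by omega)
  have h8 : 8 * t < 2 ^ (Ln + 1) := Nat.lt_pow_succ_log_self one_lt_two (8 * t)
  have h2Ln : 16 * t ≤ 2 ^ (Ln + 2) := by
    have : 2 ^ (Ln + 2) = 2 * 2 ^ (Ln + 1) := by ring
    omega
  have hNlt : N < 2 ^ ((Ln + 2) * (K + 1)) :=
    calc N < (8 * (t + 1)) ^ K * (2 * (t + 1) + 1) := Nat.lt_of_not_le hnot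
      _ ≤ (16 * t) ^ (K + 1) := h16
      _ ≤ (2 ^ (Ln + 2)) ^ (K + 1) := Nat.pow_le_pow_left h2Ln _
      _ = 2 ^ ((Ln + 2) * (K + 1)) := by rw [← pow_mul]
  exact Nat.succ_le_of_lt ((Nat.log_lt_iff_lt_pow one_lt_two hN0).2 hNlt)

/-- **THE PROVED EDGE `MultiRingDistOdd → GridCoreDistOdd`** (weighted packing; same `θ`). [kernel] -/
theorem gridCoreDistOdd_of_multiRingDistOdd (h : (∀ (p : ℕ) [Fact p.Prime], 5 ≤ p → ∃ θ : ℝ, θ < 1 ∧ ∀ c : ℕ, ∃ K t₀ : ℕ, ∀ t ≥ t₀, ∃ wt : (Fin (8 * t) → Bool) → ℕ, 0 < ∑ y, wt y ∧ ∀ P : Fin ((8 * t) ^ K) → Fin (8 * t) → Literature.Computability.MetaComplexity.Smolensky.CubeFn (ZMod p) ((8 * t) ^ K * (8 * t)), (∀ j i, P j i ∈ Literature.Computability.MetaComplexity.Smolensky.lowDeg (ZMod p) ((8 * t) ^ K * (8 * t)) ((Nat.log 2 (8 * t)) ^ c)) → (∑ X ∈ Finset.univ.filter (fun X : Fin ((8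 * t) ^ K) → Fin (8 * t) → Bool => ∀ j, Literature.Computability.QuantumComplexity.RingHLF.Rel (X j) (fun i => decide (P j i (fun kk => X (finProdFinEquiv.symm kk).1 (finProdFinEquiv.symm kk).2) = 1))), ∏ j, ((wt (X j) : ℕ) : ℝ)) ≤ θ * ((∑ y, wt y : ℕ) : ℝ) ^ ((8 * t) ^ K))) : GridCoreDistOdd := by
  intro p _ hp
  obtain ⟨θ, hθ, hc⟩ := h p hp
  refine ⟨θ, hθ, fun c => ?_⟩
  -- many-ring hardness at degree exponent `c + 1`
  obtain ⟨K, t₀, ht₀⟩ := hc (c + 1)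
  set A : ℕ := 3 * (K + 1) with hA
  set t₁ : ℕ := max (max 2 t₀) (2 ^ (A ^ c)) with ht₁
  have ht₁2 : 2 ≤ t₁ := le_trans (le_max_left _ _) (le_max_left _ _)
  have ht₁t₀ : t₀ ≤ t₁ := le_trans (le_max_right _ _) (le_max_left _ _)
  have ht₁A : 2 ^ (A ^ c) ≤ t₁ := le_max_right _ _
  refine ⟨(8 * t₁) ^ K * (2 * t₁ + 1), fun N hN => ?_⟩
  have hNt₁ : (8 * t₁) ^ K * (2 * t₁ + 1) ≤ N := hN
  have ht₁N : t₁ ≤ N := by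
    have h1 : 1 ≤ (8 * t₁) ^ K := Nat.one_le_pow _ _ (by omega)
    have h2 : 2 * t₁ + 1 ≤ (8 * t₁) ^ K * (2 * t₁ + 1) := Nat.le_mul_of_pos_left _ h1
    omega
  have hN0 : N ≠ 0 := by omega
  -- the maximal admissible half-side `t`
  set t : ℕ := Nat.findGreatest (fun t => (8 * t) ^ K * (2 * t + 1) ≤ N) N with ht
  have ht₁t : t₁ ≤ t := Nat.le_findGreatest ht₁N hNt₁
  have hPt : (8 * t) ^ K * (2 * t + 1) ≤ N :=
    Nat.findGreatest_spec (P := fun t => (8 * t) ^ K * (2 * t + 1) ≤ N) ht₁N hNt₁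
  have ht2 : 2 ≤ t := ht₁2.trans ht₁t
  have hn3 : 3 ≤ 8 * t := by omega
  have htt₀ : t₀ ≤ t := ht₁t₀.trans ht₁t
  have htA : 2 ^ (A ^ c) ≤ 8 * t := by omega
  have hJ0 : 0 < (8 * t) ^ K := Nat.pos_of_ne_zero (by positivity)
  have ht1N : t + 1 ≤ N := by
    have h1 : 1 ≤ (8 * t) ^ K := Nat.one_le_pow _ _ (by omega)
    have h2 : 2 * t + 1 ≤ (8 * t) ^ K * (2 * t + 1) := Nat.le_mul_of_pos_left _ h1
    omega
  have hnot : ¬ ((8 * (t + 1)) ^ K * (2 * (t + 1) + 1) ≤ N) :=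
    Nat.findGreatest_is_greatest (P := fun t => (8 * t) ^ K * (2 * t + 1) ≤ N)
      (by rw [ht]; exact Nat.lt_succ_self _) ht1N
  -- the packing
  let Γ : GridCycles N ((8 * t) ^ K) (8 * t) := GridCycles.rowSquares N ((8 * t) ^ K) t ht2 hJ0 hPt
  -- degree arithmetic: `(log₂ N)^c ≤ (log₂ 8t)^{c+1}`
  have hL1 : Nat.log 2 N + 1 ≤ (Nat.log 2 (8 * t) + 2) * (K + 1) := log_bound_of_maximal hN0 (by omega) hnot
  have hLn1 : 1 ≤ Nat.log 2 (8 * t) := Nat.le_log_of_pow_le one_lt_two (by omega)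
  have hALn : A ^ c ≤ Nat.log 2 (8 * t) := Nat.le_log_of_pow_le one_lt_two htA
  have hdeg : (Nat.log 2 N) ^ c ≤ (Nat.log 2 (8 * t)) ^ (c + 1) :=
    degree_bound_dist hL1 hLn1 (by rw [← hA]; exact hALn)
  -- the weight at this `t`
  obtain ⟨wt, hwt, hwin⟩ := ht₀ t htt₀
  -- the family of many-ring instances and its product weights
  let f : (Fin ((8 * t) ^ K) → Fin (8 * t) → Bool) → HLFInstance N := fun X => Γ.ringsInstance X
  let ωN : (Fin ((8 * t) ^ K) → Fin (8 * t) → Bool) → ℕ := fun X => ∏ j, wt (X j)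
  let H : Finset (HLFInstance N) := univ.image f
  let wtH : HLFInstance N → ℕ := fun I => ∑ X ∈ univ.filter (fun X => f X = I), ωN X
  have hfib : ∀ S : Finset (HLFInstance N),
      ∑ I ∈ S, wtH I = ∑ X ∈ univ.filter (fun X => f X ∈ S), ωN X := fun S =>
    Finset.sum_fiberwise_eq_sum_filter _ _ _ _
  have hprod : ∑ X : Fin ((8 * t) ^ K) → Fin (8 * t) → Bool, ωN X = (∑ y, wt y) ^ ((8 * t) ^ K) := by
    have h1 := Fintype.prod_sum fun (_ : Fin ((8 * t) ^ K)) (y : Fin (8 * t) → Bool) => wt y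
    rw [Finset.prod_const, Finset.card_univ, Fintype.card_fin] at h1
    exact h1.symm
  have hsumH : ∑ I ∈ H, wtH I = (∑ y, wt y) ^ ((8 * t) ^ K) := by
    rw [hfib H, ← hprod]
    apply Finset.sum_congr _ (fun _ _ => rfl)
    ext X
    simp only [mem_filter, mem_univ, true_and, H]
    exact ⟨fun _ => trivial, fun _ => Finset.mem_image_of_mem f (mem_univ X)⟩
  refine ⟨H, wtH, ?_, ?_, fun P hP => ?_⟩
  · rw [hsumH]; exact pow_pos hwt _
  · intro I hI
    obtain ⟨X, -, rfl⟩ := Finset.mem_image.mp hI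
    exact GridCycles.ringsInstance_isValid X
  -- the induced joint strategy for all rings
  let e : (Fin ((8 * t) ^ K * (8 * t)) → Bool) → (Fin (inLen N) → Bool) :=
    fun u => encodeHLF (Γ.ringsInstance (unflat u))
  have hemb : ∀ cc, (∃ b, ∀ u, e u cc = b) ∨ (∃ kk, ∀ u, e u cc = u kk) := by
    intro cc
    rcases GridCycles.encodeHLF_ringsInstance_subst Γ cc with ⟨b, hb⟩ | ⟨j, i, hji⟩
    · exact Or.inl ⟨b, fun u => hb _⟩
    · exact Or.inr ⟨finProdFinEquiv (j, i), fun u => by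
        show encodeHLF (Γ.ringsInstance (unflat u)) cc = u (finProdFinEquiv (j, i))
        rw [hji]; rfl⟩
  let Q : Fin ((8 * t) ^ K) → Fin (8 * t) → Smolensky.CubeFn (ZMod p) ((8 * t) ^ K * (8 * t)) :=
    fun j i u => P (Γ.toFun j i) (e u)
  have hQ : ∀ j i, Q j i ∈ Smolensky.lowDeg (ZMod p) ((8 * t) ^ K * (8 * t)) ((Nat.log 2 (8 * t)) ^ (c + 1)) :=
    fun j i => Smolensky.lowDeg_mono hdeg (Smolensky.comp_subst_mem_lowDeg e hemb (hP (Γ.toFun j i)))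
  have hB := hwin Q hQ
  -- a grid win is an all-rings win
  have hsub : (univ.filter fun X : Fin ((8 * t) ^ K) → Fin (8 * t) → Bool =>
        f X ∈ H.filter (fun I => (fun v => decide (P v (encodeHLF I) = 1)) ∈ hlfSolutions I))
      ⊆ univ.filter fun X : Fin ((8 * t) ^ K) → Fin (8 * t) → Bool => ∀ j, RingHLF.Rel (X j)
          (fun i => decide (Q j i (fun kk => X (finProdFinEquiv.symm kk).1 (finProdFinEquiv.symm kk).2) = 1)) := by
    intro X hX
    simp only [mem_filter, mem_univ, true_and] at hX ⊢
    intro j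
    have hz := GridCycles.rel_of_mem_hlfSolutions hn3 X hX.2 j
    have hfu : unflat (fun kk : Fin ((8 * t) ^ K * (8 * t)) =>
        X (finProdFinEquiv.symm kk).1 (finProdFinEquiv.symm kk).2) = X := unflat_flat_fun X
    simp only [Q, e, hfu]
    exact hz
  calc ((∑ I ∈ H.filter (fun I => (fun v => decide (P v (encodeHLF I) = 1)) ∈ hlfSolutions I), wtH I : ℕ) : ℝ)
      = ((∑ X ∈ univ.filter (fun X : Fin ((8 * t) ^ K) → Fin (8 * t) → Bool =>
          f X ∈ H.filter (fun I => (fun v => decide (P v (encodeHLF I) = 1)) ∈ hlfSolutions I)), ωN X : ℕ) : ℝ) := by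
        rw [hfib]
    _ ≤ ((∑ X ∈ univ.filter (fun X : Fin ((8 * t) ^ K) → Fin (8 * t) → Bool => ∀ j, RingHLF.Rel (X j)
          (fun i => decide (Q j i (fun kk => X (finProdFinEquiv.symm kk).1 (finProdFinEquiv.symm kk).2) = 1))),
          ωN X : ℕ) : ℝ) := by
        exact_mod_cast Finset.sum_le_sum_of_subset hsub
    _ = ∑ X ∈ univ.filter (fun X : Fin ((8 * t) ^ K) → Fin (8 * t) → Bool => ∀ j, RingHLF.Rel (X j)
          (fun i => decide (Q j i (fun kk => X (finProdFinEquiv.symm kk).1 (finProdFinEquiv.symm kk).2) = 1))),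
          ∏ j, ((wt (X j) : ℕ) : ℝ) := by
        push_cast [ωN]; rfl
    _ ≤ θ * ((∑ y, wt y : ℕ) : ℝ) ^ ((8 * t) ^ K) := hB
    _ = θ * ((∑ I ∈ H, wtH I : ℕ) : ℝ) := by rw [hsumH]; push_cast; rfl

/-! ## Part F.  Composition: the bridge, dominance of 28223, conditional leaf, order records -/

/-- **T**_μ decides T***: `SpreadDistOdd → GridCoreDistOdd`** (weighted hybrid ∘ weighted packing, PROVED). -/
theorem gridCoreDistOdd_of_spreadDistOdd (h : (∀ (p : ℕ) [Fact p.Prime], 5 ≤ p → ∃ η : ℝ, 0 < η ∧ ∀ c : ℕ, ∃ k t₀ : ℕ, ∀ t ≥ t₀, ∃ wt : (Fin (8 * t) → Bool) → ℕ, 0 < ∑ y, wt y ∧ ∀ P : Fin (8 * t) → Literature.Computability.MetaComplexity.Smolensky.CubeFn (ZMod p) (8 * t), (∀ i, P i ∈ Literature.Computability.MetaComplexity.Smolensky.lowDeg (ZMod p) (8 * t) ((Nat.log 2 (8 * t)) ^ c)) → ∀ m : ℕ, m ≤ (8 * t) ^ k → ∀ w : Fin m → Fin (8 * t) → Bool,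 ∀ Q : Fin m → Fin (8 * t) → Literature.Computability.MetaComplexity.Smolensky.CubeFn (ZMod p) (8 * t), (∀ s i, Q s i ∈ Literature.Computability.MetaComplexity.Smolensky.lowDeg (ZMod p) (8 * t) ((Nat.log 2 (8 * t)) ^ c)) → (1 - η) * ((∑ y, wt y : ℕ) : ℝ) ≤ ((∑ y ∈ Finset.univ.filter (fun y : Fin (8 * t) → Bool => ∀ s, Literature.Computability.QuantumComplexity.RingHLF.Rel (w s) (fun i => decide (Q s i y = 1))), wt y : ℕ) : ℝ) → 1 / (((8 * t : ℕ) : ℝ)) ^ k * ((∑ y, wt y : ℕ) : ℝ) ≤ ((∑ y ∈ Finset.univ.filter (fun y : Fin (8 * t) → Bool => (∀ s, Literature.Computability.QuantumComplexity.RingHLF.Rel (w s) (fun i => decide (Q s i y = 1))) ∧ ¬ Literature.Computability.QuantumComplexity.RingHLF.Rel y (fun i => decide (P i y = 1))), wt y : ℕ) : ℝ))) : GridCoreDistOdd :=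
  gridCoreDistOdd_of_multiRingDistOdd (multiRingDistOdd_of_spreadDistOdd h)

/-- **DOMINANCE**: the new residual implies the old one — `CoverLiftDistOdd → DistLiftOdd` (HardCore:28223). -/
theorem distLiftOdd_of_coverLiftDistOdd (h : (RingPolyLoss8Odd → (∀ (p : ℕ) [Fact p.Prime], 5 ≤ p → ∃ η : ℝ, 0 < η ∧ ∀ c : ℕ, ∃ k t₀ : ℕ, ∀ t ≥ t₀, ∃ wt : (Fin (8 * t) → Bool) → ℕ, 0 < ∑ y, wt y ∧ ∀ P : Fin (8 * t) → Literature.Computability.MetaComplexity.Smolensky.CubeFn (ZMod p) (8 * t), (∀ i, P i ∈ Literature.Computability.MetaComplexity.Smolensky.lowDeg (ZMod p) (8 * t) ((Nat.log 2 (8 * t)) ^ c)) → ∀ m : ℕ, m ≤ (8 * t) ^ k → ∀ w : Fin m → Fin (8 * t) → Bool, ∀ Q : Fin m → Fin (8 * t) → Literature.Computability.MetaComplexity.Smolensky.CubeFn (ZMod p) (8 * t), (∀ s i, Q s i ∈ Literature.Computability.MetaComplexity.Smolensky.lowDeg (ZMod p) (8 * t) ((Nat.log 2 (8 * t)) ^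 c)) → (1 - η) * ((∑ y, wt y : ℕ) : ℝ) ≤ ((∑ y ∈ Finset.univ.filter (fun y : Fin (8 * t) → Bool => ∀ s, Literature.Computability.QuantumComplexity.RingHLF.Rel (w s) (fun i => decide (Q s i y = 1))), wt y : ℕ) : ℝ) → 1 / (((8 * t : ℕ) : ℝ)) ^ k * ((∑ y, wt y : ℕ) : ℝ) ≤ ((∑ y ∈ Finset.univ.filter (fun y : Fin (8 * t) → Bool => (∀ s, Literature.Computability.QuantumComplexity.RingHLF.Rel (w s) (fun i => decide (Q s i y = 1))) ∧ ¬ Literature.Computability.QuantumComplexity.RingHLF.Rel y (fun i => decide (P i y = 1))), wt y : ℕ) : ℝ)))) : DistLiftOdd :=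
  fun hP => gridCoreDistOdd_of_spreadDistOdd (h hP)

/-- the flat residual also dominates 28223: `CoverLift8Odd → DistLiftOdd`. -/
theorem distLiftOdd_of_coverLift8Odd (h : (RingPolyLoss8Odd → (∀ (p : ℕ) [Fact p.Prime], 5 ≤ p → ∃ η : ℝ, 0 < η ∧ ∃ k : ℕ, ∀ c : ℕ, ∃ t₀ : ℕ, ∀ t ≥ t₀, ∀ P : Fin (8 * t) → Literature.Computability.MetaComplexity.Smolensky.CubeFn (ZMod p) (8 * t), (∀ i, P i ∈ Literature.Computability.MetaComplexity.Smolensky.lowDeg (ZMod p) (8 * t) ((Nat.log 2 (8 * t)) ^ c)) → ∀ m : ℕ, m ≤ (8 * t) ^ k → ∀ w : Fin m → Fin (8 * t) → Bool, ∀ Q : Fin m → Fin (8 * t) → Literature.Computability.MetaComplexity.Smolensky.CubeFn (ZMod p) (8 * t), (∀ s i, Q s i ∈ Literature.Computability.MetaComplexity.Smolensky.lowDeg (ZMod p) (8 * t) ((Nat.log 2 (8 * t)) ^ c)) → (1 - η) * (2 : ℝ) ^ (8 * t) ≤ ((Finset.univ.filter fun y : Fin (8 * t) → Bool => ∀ s,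 Literature.Computability.QuantumComplexity.RingHLF.Rel (w s) (fun i => decide (Q s i y = 1))).card : ℝ) → 1 / (((8 * t : ℕ) : ℝ)) ^ k * (2 : ℝ) ^ (8 * t) ≤ ((Finset.univ.filter fun y : Fin (8 * t) → Bool => (∀ s, Literature.Computability.QuantumComplexity.RingHLF.Rel (w s) (fun i => decide (Q s i y = 1))) ∧ ¬ Literature.Computability.QuantumComplexity.RingHLF.Rel y (fun i => decide (P i y = 1))).card : ℝ)))) : DistLiftOdd :=
  distLiftOdd_of_coverLiftDistOdd (coverLiftDistOdd_of_coverLift8Odd h)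

/-- JUNCTION WITH LENS-5's BridgeDial at odd `p`: the flat many-ring grade (the hypothesis class of
`hlfNotFAC0Mod_of_multiRing`, restricted to ring lengths `8t`) reaches the measure closure T*** —
`MultiRingHard8Odd → GridCoreDistOdd` (PROVED; composes with HardCore:28224 to the leaf). -/
theorem gridCoreDistOdd_of_multiRingHard8Odd (h : (∀ (p : ℕ) [Fact p.Prime], 5 ≤ p → ∃ θ : ℝ, θ < 1 ∧ ∀ c : ℕ, ∃ K t₀ : ℕ, ∀ t ≥ t₀, ∀ P : Fin ((8 * t) ^ K) → Fin (8 * t) → Literature.Computability.MetaComplexity.Smolensky.CubeFn (ZMod p) ((8 * t) ^ K * (8 * t)), (∀ j i, P j i ∈ Literature.Computability.MetaComplexity.Smolensky.lowDeg (ZMod p) ((8 * t) ^ K * (8 * t)) ((Nat.log 2 (8 * t)) ^ c)) → ((Finset.univ.filter fun X : Fin ((8 * t) ^ K) → Fin (8 * t) → Bool => ∀ j, Literature.Computability.QuantumComplexity.RingHLF.Rel (X j) (fun i => decide (P j i (fun kk => X (finProdFinEquiv.symm kk).1 (finProdFinEquiv.symm kk).2) = 1))).card : ℝ) ≤ θ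 * (2 : ℝ) ^ ((8 * t) ^ K * (8 * t)))) : GridCoreDistOdd :=
  gridCoreDistOdd_of_multiRingDistOdd (multiRingDistOdd_of_multiRingHard8Odd h)

/-- order record: T* reaches T*** through the product road as well (g4 proved the direct edge). -/
theorem gridCoreDistOdd_of_ringCore8Odd (h : RingCore8Odd) : GridCoreDistOdd :=
  gridCoreDistOdd_of_spreadDistOdd (spreadDistOdd_of_ringCore8Odd h)

/-- NECESSITY of every binder for the X-form thesis. -/
theorem gridCoreDistOdd_of_xform (h : ∀ (p : ℕ) [Fact p.Prime], 5 ≤ p → WalkHardF p) : GridCoreDistOdd :=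
  gridCoreDistOdd_of_spreadDistOdd (spreadDistOdd_of_xform h)

/-- SpreadCore bridge helper `coverLiftDistOdd_of_xform` (lens-6 g6 SpreadCoreBridge v2; see the enclosing section docstring). -/
theorem coverLiftDistOdd_of_xform (h : ∀ (p : ℕ) [Fact p.Prime], 5 ≤ p → WalkHardF p) : (RingPolyLoss8Odd → (∀ (p : ℕ) [Fact p.Prime], 5 ≤ p → ∃ η : ℝ, 0 < η ∧ ∀ c : ℕ, ∃ k t₀ : ℕ, ∀ t ≥ t₀, ∃ wt : (Fin (8 * t) → Bool) → ℕ, 0 < ∑ y, wt y ∧ ∀ P : Fin (8 * t) → Literature.Computability.MetaComplexity.Smolensky.CubeFn (ZMod p) (8 * t), (∀ i, P i ∈ Literature.Computability.MetaComplexity.Smolensky.lowDeg (ZMod p) (8 * t) ((Nat.log 2 (8 * t)) ^ c)) → ∀ m : ℕ, m ≤ (8 * t) ^ k → ∀ w : Fin m → Fin (8 * t) → Bool, ∀ Q : Fin m → Fin (8 * t) → Literature.Computability.MetaComplexity.Smolensky.CubeFn (ZMod p) (8 * t), (∀ s i, Q s i ∈ Literature.Computability.MetaComplexity.Smolensky.lowDeg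 (ZMod p) (8 * t) ((Nat.log 2 (8 * t)) ^ c)) → (1 - η) * ((∑ y, wt y : ℕ) : ℝ) ≤ ((∑ y ∈ Finset.univ.filter (fun y : Fin (8 * t) → Bool => ∀ s, Literature.Computability.QuantumComplexity.RingHLF.Rel (w s) (fun i => decide (Q s i y = 1))), wt y : ℕ) : ℝ) → 1 / (((8 * t : ℕ) : ℝ)) ^ k * ((∑ y, wt y : ℕ) : ℝ) ≤ ((∑ y ∈ Finset.univ.filter (fun y : Fin (8 * t) → Bool => (∀ s, Literature.Computability.QuantumComplexity.RingHLF.Rel (w s) (fun i => decide (Q s i y = 1))) ∧ ¬ Literature.Computability.QuantumComplexity.RingHLF.Rel y (fun i => decide (P i y = 1))), wt y : ℕ) : ℝ))) :=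
  fun _ => spreadDistOdd_of_xform h

/-- **THE DECIDING THEOREM of the node** (crux-only shape; every binder load-bearing):
`RingPolyLoss8Odd → CoverLiftDistOdd → DistBridgeOdd → AdviceFreeQNC0Odd`. -/
theorem adviceFreeQNC0Odd_of_coverLiftDistOdd (hP : RingPolyLoss8Odd) (hC : (RingPolyLoss8Odd → (∀ (p : ℕ) [Fact p.Prime], 5 ≤ p → ∃ η : ℝ, 0 < η ∧ ∀ c : ℕ, ∃ k t₀ : ℕ, ∀ t ≥ t₀, ∃ wt : (Fin (8 * t) → Bool) → ℕ, 0 < ∑ y, wt y ∧ ∀ P : Fin (8 * t) → Literature.Computability.MetaComplexity.Smolensky.CubeFn (ZMod p) (8 * t), (∀ i, P i ∈ Literature.Computability.MetaComplexity.Smolensky.lowDeg (ZMod p) (8 * t) ((Nat.log 2 (8 * t)) ^ c)) → ∀ m : ℕ, m ≤ (8 * t) ^ k → ∀ w : Fin m → Fin (8 * t) → Bool, ∀ Q : Fin m → Fin (8 * t) → Literature.Computability.MetaComplexity.Smolensky.CubeFn (ZMod p) (8 * t), (∀ s i, Q s i ∈ Literature.Computability.MetaComplexity.Smolensky.lowDeg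 (ZMod p) (8 * t) ((Nat.log 2 (8 * t)) ^ c)) → (1 - η) * ((∑ y, wt y : ℕ) : ℝ) ≤ ((∑ y ∈ Finset.univ.filter (fun y : Fin (8 * t) → Bool => ∀ s, Literature.Computability.QuantumComplexity.RingHLF.Rel (w s) (fun i => decide (Q s i y = 1))), wt y : ℕ) : ℝ) → 1 / (((8 * t : ℕ) : ℝ)) ^ k * ((∑ y, wt y : ℕ) : ℝ) ≤ ((∑ y ∈ Finset.univ.filter (fun y : Fin (8 * t) → Bool => (∀ s, Literature.Computability.QuantumComplexity.RingHLF.Rel (w s) (fun i => decide (Q s i y = 1))) ∧ ¬ Literature.Computability.QuantumComplexity.RingHLF.Rel y (fun i => decide (P i y = 1))), wt y : ℕ) : ℝ)))) (hB : DistBridgeOdd) :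
    Summit.QuantumAdvantage.AdviceFreeQNC0.AdviceFreeQNC0Odd :=
  hB (gridCoreDistOdd_of_spreadDistOdd (hC hP))

/-- two-binder form: T**_μ and the grid bridge decide the leaf. -/
theorem adviceFreeQNC0Odd_of_spreadDistOdd (hS : (∀ (p : ℕ) [Fact p.Prime], 5 ≤ p → ∃ η : ℝ, 0 < η ∧ ∀ c : ℕ, ∃ k t₀ : ℕ, ∀ t ≥ t₀, ∃ wt : (Fin (8 * t) → Bool) → ℕ, 0 < ∑ y, wt y ∧ ∀ P : Fin (8 * t) → Literature.Computability.MetaComplexity.Smolensky.CubeFn (ZMod p) (8 * t), (∀ i, P i ∈ Literature.Computability.MetaComplexity.Smolensky.lowDeg (ZMod p) (8 * t) ((Nat.log 2 (8 * t)) ^ c)) → ∀ m : ℕ, m ≤ (8 * t) ^ k → ∀ w : Fin m → Fin (8 * t) → Bool, ∀ Q : Fin m → Fin (8 * t) → Literature.Computability.MetaComplexity.Smolensky.CubeFn (ZMod p) (8 * t), (∀ s i, Q s i ∈ Literature.Computability.MetaComplexity.Smolensky.lowDeg (ZMod p) (8 * t) ((Nat.log 2 (8 * t)) ^ c)) → (1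 - η) * ((∑ y, wt y : ℕ) : ℝ) ≤ ((∑ y ∈ Finset.univ.filter (fun y : Fin (8 * t) → Bool => ∀ s, Literature.Computability.QuantumComplexity.RingHLF.Rel (w s) (fun i => decide (Q s i y = 1))), wt y : ℕ) : ℝ) → 1 / (((8 * t : ℕ) : ℝ)) ^ k * ((∑ y, wt y : ℕ) : ℝ) ≤ ((∑ y ∈ Finset.univ.filter (fun y : Fin (8 * t) → Bool => (∀ s, Literature.Computability.QuantumComplexity.RingHLF.Rel (w s) (fun i => decide (Q s i y = 1))) ∧ ¬ Literature.Computability.QuantumComplexity.RingHLF.Rel y (fun i => decide (P i y = 1))), wt y : ℕ) : ℝ))) (hB : DistBridgeOdd) :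
    Summit.QuantumAdvantage.AdviceFreeQNC0.AdviceFreeQNC0Odd :=
  hB (gridCoreDistOdd_of_spreadDistOdd hS)

/-- flat form (the uniform odd-p port of lens-5's SpreadDial closes, composed with the measure-closure bridge). -/
theorem adviceFreeQNC0Odd_of_coverLift8Odd (hP : RingPolyLoss8Odd) (hC : (RingPolyLoss8Odd → (∀ (p : ℕ) [Fact p.Prime], 5 ≤ p → ∃ η : ℝ, 0 < η ∧ ∃ k : ℕ, ∀ c : ℕ, ∃ t₀ : ℕ, ∀ t ≥ t₀, ∀ P : Fin (8 * t) → Literature.Computability.MetaComplexity.Smolensky.CubeFn (ZMod p) (8 * t), (∀ i, P i ∈ Literature.Computability.MetaComplexity.Smolensky.lowDeg (ZMod p) (8 * t) ((Nat.log 2 (8 * t)) ^ c)) → ∀ m : ℕ, m ≤ (8 * t) ^ k → ∀ w : Fin m → Fin (8 * t) → Bool, ∀ Q : Fin m → Fin (8 * t) → Literature.Computability.MetaComplexity.Smolensky.CubeFn (ZMod p) (8 * t), (∀ s i, Q s i ∈ Literature.Computability.MetaComplexity.Smolensky.lowDeg (ZMod p) (8 * t) ((Nat.log 2 (8 * t))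 ^ c)) → (1 - η) * (2 : ℝ) ^ (8 * t) ≤ ((Finset.univ.filter fun y : Fin (8 * t) → Bool => ∀ s, Literature.Computability.QuantumComplexity.RingHLF.Rel (w s) (fun i => decide (Q s i y = 1))).card : ℝ) → 1 / (((8 * t : ℕ) : ℝ)) ^ k * (2 : ℝ) ^ (8 * t) ≤ ((Finset.univ.filter fun y : Fin (8 * t) → Bool => (∀ s, Literature.Computability.QuantumComplexity.RingHLF.Rel (w s) (fun i => decide (Q s i y = 1))) ∧ ¬ Literature.Computability.QuantumComplexity.RingHLF.Rel y (fun i => decide (P i y = 1))).card : ℝ)))) (hB : DistBridgeOdd) :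
    Summit.QuantumAdvantage.AdviceFreeQNC0.AdviceFreeQNC0Odd :=
  adviceFreeQNC0Odd_of_coverLiftDistOdd hP (coverLiftDistOdd_of_coverLift8Odd hC) hB



/-! ## Part G.  LAW (L-escape): foreign-spread loss = loss sets ESCAPE every light low-degree test

The `m = 1` content of `SpreadWtAt`, made explicit: take ONE foreign ring with a fixed pattern `w` admitting a valid
answer `zv` and an invalid answer `zi`, and answer it by `z(y) = zv` if `g(y) = 0`, `zi` if `g(y) = 1` for a
`{0,1}`-valued low-degree `g` (outputs `[zv i] + g·([zi i] - [zv i])`, same degree as `g`).  Its win event is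
`{g ≠ 1}`; so weighted spread forces: **no victim's loss set is `(8t)^{-k}`-almost contained (in `wt`-weight) in a
low-degree set `{g = 1}` of weight `≤ η·Σwt`.**  This is the structure-vs-randomness face of the residual
`CoverLiftDistOdd`: under the designable measure, loss sets of polylog-degree strategies must be ANTI-CONCENTRATED
against polylog-degree tests (kill lane / census instrument K-SPREAD below). -/

section EscapeLaw

/-- the Boolean embedding `[b] ∈ {0,1} ⊆ 𝔽_p`. -/
def bit {p : ℕ} (b : Bool) : ZMod p := if b then 1 else 0

/-- SpreadCore bridge helper `bit_true` (lens-6 g6 SpreadCoreBridge v2; see the enclosing section docstring). -/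
@[simp] theorem bit_true {p : ℕ} : (bit true : ZMod p) = 1 := rfl
/-- SpreadCore bridge helper `bit_false` (lens-6 g6 SpreadCoreBridge v2; see the enclosing section docstring). -/
@[simp] theorem bit_false {p : ℕ} : (bit false : ZMod p) = 0 := rfl

variable {p : ℕ} [Fact p.Prime]

/-- the steered foreign answer: `zv` where `g = 0`, `zi` where `g = 1`. -/
def steer {n : ℕ} (g : Smolensky.CubeFn (ZMod p) n) (zv zi : Fin n → Bool) (i : Fin n) :
    Smolensky.CubeFn (ZMod p) n :=
  (bit (zv i) : ZMod p) • (1 : Smolensky.CubeFn (ZMod p) n) + ((bit (zi i) : ZMod p) - bit (zv i)) • g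

/-- SpreadCore bridge helper `one_mem_lowDeg` (lens-6 g6 SpreadCoreBridge v2; see the enclosing section docstring). -/
theorem one_mem_lowDeg (n D : ℕ) : (1 : Smolensky.CubeFn (ZMod p) n) ∈ Smolensky.lowDeg (ZMod p) n D := by
  have h := Smolensky.mono_mem_lowDeg (F := ZMod p) (S := (∅ : Finset (Fin n))) (D := D) (by simp)
  simpa using h

/-- SpreadCore bridge helper `steer_mem_lowDeg` (lens-6 g6 SpreadCoreBridge v2; see the enclosing section docstring). -/
theorem steer_mem_lowDeg {n D : ℕ} {g : Smolensky.CubeFn (ZMod p) n} (hg : g ∈ Smolensky.lowDeg (ZMod p) n D)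
    (zv zi : Fin n → Bool) (i : Fin n) : steer g zv zi i ∈ Smolensky.lowDeg (ZMod p) n D :=
  Submodule.add_mem _ (Submodule.smul_mem _ _ (one_mem_lowDeg n D)) (Submodule.smul_mem _ _ hg)

/-- the steered answer decodes to `zv` off `{g = 1}` and to `zi` on it. -/
theorem steer_decide {n : ℕ} (g : Smolensky.CubeFn (ZMod p) n) (hg01 : ∀ y, g y = 0 ∨ g y = 1)
    (zv zi : Fin n → Bool) (y : Fin n → Bool) :
    (fun i => decide (steer g zv zi i y = 1)) = if g y = 1 then zi else zv := by
  funext i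
  simp only [steer, Pi.add_apply, Pi.smul_apply, Pi.one_apply, smul_eq_mul, mul_one]
  rcases hg01 y with h0 | h1
  · rw [h0, if_neg zero_ne_one]
    cases zv i <;> cases zi i <;> simp
  · rw [h1, if_pos rfl]
    cases zv i <;> cases zi i <;> simp

/-- **LAW (L-escape)**: under `SpreadWtAt p η k δ t wt`, for every victim `P` of degree `≤ δ t`, every fixed pattern
`w` with a valid and an invalid answer, and every `{0,1}`-valued `g` of degree `≤ δ t` whose `1`-set is `η`-light:
the loss of `P` OUTSIDE `{g = 1}` weighs at least `(8t)^{-k}·Σwt`. -/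
theorem loss_escapes_lowDeg_test {η : ℝ} {k : ℕ} {δ : ℕ → ℕ} {t : ℕ} {wt : (Fin (8 * t) → Bool) → ℕ}
    (hS : (∀ P : Fin (8 * t) → Smolensky.CubeFn (ZMod p) (8 * t), (∀ i, P i ∈ Smolensky.lowDeg (ZMod p) (8 * t) (δ t)) → ∀ m : ℕ, m ≤ (8 * t) ^ k → ∀ w : Fin m → Fin (8 * t) → Bool, ∀ Q : Fin m → Fin (8 * t) → Smolensky.CubeFn (ZMod p) (8 * t), (∀ s i, Q s i ∈ Smolensky.lowDeg (ZMod p) (8 * t) (δ t)) → (1 - η) * ((∑ y, wt y : ℕ) : ℝ) ≤ ((∑ y ∈ univ.filter (fun y : Fin (8 * t) → Bool => ∀ s, RingHLF.Rel (w s) (fun i => decide (Q s i y = 1))), wt y : ℕ) : ℝ) → 1 / (((8 * t : ℕ) : ℝ)) ^ k * ((∑ y, wt y : ℕ) : ℝ) ≤ ((∑ y ∈ univ.filter (fun y : Fin (8 * t) → Bool => (∀ s, RingHLF.Rel (w s) (fun i => decide (Q s i y = 1))) ∧ ¬ RingHLF.Rel y (fun i => decide (P i y = 1))), wt y : ℕ)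 : ℝ))) (hk : 1 ≤ (8 * t) ^ k)
    (P : Fin (8 * t) → Smolensky.CubeFn (ZMod p) (8 * t))
    (hP : ∀ i, P i ∈ Smolensky.lowDeg (ZMod p) (8 * t) (δ t))
    {w zv zi : Fin (8 * t) → Bool} (hv : RingHLF.Rel w zv) (hi : ¬ RingHLF.Rel w zi)
    {g : Smolensky.CubeFn (ZMod p) (8 * t)} (hg : g ∈ Smolensky.lowDeg (ZMod p) (8 * t) (δ t))
    (hg01 : ∀ y, g y = 0 ∨ g y = 1)
    (hlight : ((∑ y ∈ univ.filter (fun y : Fin (8 * t) → Bool => g y = 1), wt y : ℕ) : ℝ)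
      ≤ η * ((∑ y, wt y : ℕ) : ℝ)) :
    1 / (((8 * t : ℕ) : ℝ)) ^ k * ((∑ y, wt y : ℕ) : ℝ) ≤
      ((∑ y ∈ univ.filter (fun y : Fin (8 * t) → Bool =>
        g y ≠ 1 ∧ ¬ RingHLF.Rel y (fun i => decide (P i y = 1))), wt y : ℕ) : ℝ) := by
  -- the steered foreign ring
  have hrel : ∀ y : Fin (8 * t) → Bool,
      (∀ s : Fin 1, RingHLF.Rel ((fun _ : Fin 1 => w) s) (fun i => decide (steer g zv zi i y = 1))) ↔ g y ≠ 1 := by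
    intro y
    rw [steer_decide g hg01 zv zi y]
    constructor
    · intro h h1
      have h0 := h 0
      rw [if_pos h1] at h0
      exact hi h0
    · intro h s
      rw [if_neg h]
      exact hv
  have hEeq : (univ.filter fun y : Fin (8 * t) → Bool =>
      ∀ s : Fin 1, RingHLF.Rel ((fun _ : Fin 1 => w) s) (fun i => decide (steer g zv zi i y = 1)))
      = univ.filter fun y : Fin (8 * t) → Bool => g y ≠ 1 := by
    ext y; simp only [mem_filter, mem_univ, true_and, hrel]
  have hLeq : (univ.filter fun y : Fin (8 * t) → Bool =>
      (∀ s : Fin 1, RingHLF.Rel ((fun _ : Fin 1 => w) s) (fun i => decide (steer g zv zi i y = 1))) ∧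
        ¬ RingHLF.Rel y (fun i => decide (P i y = 1)))
      = univ.filter fun y : Fin (8 * t) → Bool => g y ≠ 1 ∧ ¬ RingHLF.Rel y (fun i => decide (P i y = 1)) := by
    ext y; simp only [mem_filter, mem_univ, true_and, hrel]
  -- the event `{g ≠ 1}` is heavy
  have hsplit := Finset.sum_filter_add_sum_filter_not (univ : Finset (Fin (8 * t) → Bool))
    (fun y : Fin (8 * t) → Bool => g y = 1) (fun y => wt y)
  have hheavy : (1 - η) * ((∑ y, wt y : ℕ) : ℝ) ≤
      ((∑ y ∈ univ.filter (fun y : Fin (8 * t) → Bool => g y ≠ 1), wt y : ℕ) : ℝ) := by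
    have h2 : ((∑ y ∈ univ.filter (fun y : Fin (8 * t) → Bool => g y = 1), wt y : ℕ) : ℝ) +
        ((∑ y ∈ univ.filter (fun y : Fin (8 * t) → Bool => ¬ g y = 1), wt y : ℕ) : ℝ) = ((∑ y, wt y : ℕ) : ℝ) := by
      exact_mod_cast hsplit
    have h3 : (univ.filter fun y : Fin (8 * t) → Bool => ¬ g y = 1) = univ.filter fun y : Fin (8 * t) → Bool => g y ≠ 1 := rfl
    rw [h3] at h2
    linarith
  have h := hS P hP 1 hk (fun _ => w) (fun _ i => steer g zv zi i) (fun _ i => steer_mem_lowDeg hg zv zi i)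
    (by rw [hEeq]; exact hheavy)
  rw [hLeq] at h
  exact h

end EscapeLaw

/-! ### Kill lanes (contrapositives of the PROVED necessity edges) -/

/-- refuting T**_μ refutes T* (HardCore:27578), hence `RingHard8 p₀`-type theses and the X-form. -/
theorem not_ringCore8Odd_of_not_spreadDistOdd (h : ¬ (∀ (p : ℕ) [Fact p.Prime], 5 ≤ p → ∃ η : ℝ, 0 < η ∧ ∀ c : ℕ, ∃ k t₀ : ℕ, ∀ t ≥ t₀, ∃ wt : (Fin (8 * t) → Bool) → ℕ, 0 < ∑ y, wt y ∧ ∀ P : Fin (8 * t) → Literature.Computability.MetaComplexity.Smolensky.CubeFn (ZMod p) (8 * t), (∀ i, P i ∈ Literature.Computability.MetaComplexity.Smolensky.lowDeg (ZMod p) (8 * t) ((Nat.log 2 (8 * t)) ^ c)) → ∀ m : ℕ, m ≤ (8 * t) ^ k → ∀ w : Fin m → Fin (8 * t) → Bool, ∀ Q : Fin m → Fin (8 * t) → Literature.Computability.MetaComplexity.Smolensky.CubeFn (ZMod p) (8 * t), (∀ s i, Q s i ∈ Literature.Computability.MetaComplexity.Smolensky.lowDeg (ZMod p) (8 * t) ((Nat.log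 2 (8 * t)) ^ c)) → (1 - η) * ((∑ y, wt y : ℕ) : ℝ) ≤ ((∑ y ∈ Finset.univ.filter (fun y : Fin (8 * t) → Bool => ∀ s, Literature.Computability.QuantumComplexity.RingHLF.Rel (w s) (fun i => decide (Q s i y = 1))), wt y : ℕ) : ℝ) → 1 / (((8 * t : ℕ) : ℝ)) ^ k * ((∑ y, wt y : ℕ) : ℝ) ≤ ((∑ y ∈ Finset.univ.filter (fun y : Fin (8 * t) → Bool => (∀ s, Literature.Computability.QuantumComplexity.RingHLF.Rel (w s) (fun i => decide (Q s i y = 1))) ∧ ¬ Literature.Computability.QuantumComplexity.RingHLF.Rel y (fun i => decide (P i y = 1))), wt y : ℕ) : ℝ))) : ¬ RingCore8Odd :=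
  fun hT => h (spreadDistOdd_of_ringCore8Odd hT)

/-- SpreadCore bridge helper `not_xform_of_not_spreadDistOdd` (lens-6 g6 SpreadCoreBridge v2; see the enclosing section docstring). -/
theorem not_xform_of_not_spreadDistOdd (h : ¬ (∀ (p : ℕ) [Fact p.Prime], 5 ≤ p → ∃ η : ℝ, 0 < η ∧ ∀ c : ℕ, ∃ k t₀ : ℕ, ∀ t ≥ t₀, ∃ wt : (Fin (8 * t) → Bool) → ℕ, 0 < ∑ y, wt y ∧ ∀ P : Fin (8 * t) → Literature.Computability.MetaComplexity.Smolensky.CubeFn (ZMod p) (8 * t), (∀ i, P i ∈ Literature.Computability.MetaComplexity.Smolensky.lowDeg (ZMod p) (8 * t) ((Nat.log 2 (8 * t)) ^ c)) → ∀ m : ℕ, m ≤ (8 * t) ^ k → ∀ w : Fin m → Fin (8 * t) → Bool, ∀ Q : Fin m → Fin (8 * t) → Literature.Computability.MetaComplexity.Smolensky.CubeFn (ZMod p) (8 * t), (∀ s i, Q s i ∈ Literature.Computability.MetaComplexity.Smolensky.lowDeg (ZMod p) (8 * t) ((Nat.log 2 (8 * t)) ^ c)) → (1 - η) * ((∑ y,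 wt y : ℕ) : ℝ) ≤ ((∑ y ∈ Finset.univ.filter (fun y : Fin (8 * t) → Bool => ∀ s, Literature.Computability.QuantumComplexity.RingHLF.Rel (w s) (fun i => decide (Q s i y = 1))), wt y : ℕ) : ℝ) → 1 / (((8 * t : ℕ) : ℝ)) ^ k * ((∑ y, wt y : ℕ) : ℝ) ≤ ((∑ y ∈ Finset.univ.filter (fun y : Fin (8 * t) → Bool => (∀ s, Literature.Computability.QuantumComplexity.RingHLF.Rel (w s) (fun i => decide (Q s i y = 1))) ∧ ¬ Literature.Computability.QuantumComplexity.RingHLF.Rel y (fun i => decide (P i y = 1))), wt y : ℕ) : ℝ))) :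
    ¬ (∀ (p : ℕ) [Fact p.Prime], 5 ≤ p → WalkHardF p) :=
  fun hX => h (spreadDistOdd_of_xform hX)

/-- refuting the residual refutes T* as well (the residual is implied by T*). -/
theorem not_ringCore8Odd_of_not_coverLiftDistOdd (h : ¬ (RingPolyLoss8Odd → (∀ (p : ℕ) [Fact p.Prime], 5 ≤ p → ∃ η : ℝ, 0 < η ∧ ∀ c : ℕ, ∃ k t₀ : ℕ, ∀ t ≥ t₀, ∃ wt : (Fin (8 * t) → Bool) → ℕ, 0 < ∑ y, wt y ∧ ∀ P : Fin (8 * t) → Literature.Computability.MetaComplexity.Smolensky.CubeFn (ZMod p) (8 * t), (∀ i, P i ∈ Literature.Computability.MetaComplexity.Smolensky.lowDeg (ZMod p) (8 * t) ((Nat.log 2 (8 * t)) ^ c)) → ∀ m : ℕ, m ≤ (8 * t) ^ k → ∀ w : Fin m → Fin (8 * t) → Bool, ∀ Q : Fin m → Fin (8 * t) → Literature.Computability.MetaComplexity.Smolensky.CubeFn (ZMod p) (8 * t), (∀ s i, Q s i ∈ Literature.Computability.MetaComplexity.Smolensky.lowDeg (ZMod p) (8 * t) ((Nat.log 2 (8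 * t)) ^ c)) → (1 - η) * ((∑ y, wt y : ℕ) : ℝ) ≤ ((∑ y ∈ Finset.univ.filter (fun y : Fin (8 * t) → Bool => ∀ s, Literature.Computability.QuantumComplexity.RingHLF.Rel (w s) (fun i => decide (Q s i y = 1))), wt y : ℕ) : ℝ) → 1 / (((8 * t : ℕ) : ℝ)) ^ k * ((∑ y, wt y : ℕ) : ℝ) ≤ ((∑ y ∈ Finset.univ.filter (fun y : Fin (8 * t) → Bool => (∀ s, Literature.Computability.QuantumComplexity.RingHLF.Rel (w s) (fun i => decide (Q s i y = 1))) ∧ ¬ Literature.Computability.QuantumComplexity.RingHLF.Rel y (fun i => decide (P i y = 1))), wt y : ℕ) : ℝ)))) : ¬ RingCore8Odd :=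
  fun hT => h (coverLiftDistOdd_of_ringCore8Odd hT)

end Summit.QuantumAdvantage.QuantumAdvantage.Theorems.SpreadCore
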